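import Literature.NumberTheory.Automorphic.JacquetLengthTwoLabels
import Literature.NumberTheory.Automorphic.JacquetModuleFrobeniusProofs
import HarnessLib

/-!
# The labelled pair of a length-two NORMALISED-INDUCED representation `i_P^G σ` ([Casselman1995, §7.1]), one call

Generic representation theory (theorems only), a repackaging of ★ `IrrClass.labelledPair_of_line` (`JacquetLengthTwoLabels`) for
`ρ = i_P^G σ` (★ `Representation.normalizedInd`) in which
* the non-vanishing `r(ρ|_N) ≠ 0` is DERIVED from Frobenius reciprocity (★ `Representation.frobenius_normalizedInd_holds`, hypothesis
  `hδ : δ_P|_{N_P} = 1`) applied to the inclusion `ρ|_N ↪ i_P^G σ`;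
* the irreducibility of `ρ|_N`, `ρ⁄N` is DERIVED from «no `3`-chains» (★ `ConstituentsOfExtension`);
* «`θ₁` is not an exponent of `ρ|_N`» is DERIVED from an abstract decay dichotomy `hdecay : every exponent of ρ|_N satisfies D`, `hD : ¬ D θ₁`
  (the shape delivered by [Casselman1995, Thm 4.4.6] for a square-integrable `ρ|_N`);
* the ARGUMENT ORDER puts the «line data» of `r(ρ)` first, so that a caller holding that data from a cited statement elaborated elsewhere
  fixes all implicit structure from it (cell pub/hodgecm-mathlib F0∕P3, T3 «KeysCaseTwo» pay-down: elaboration-cost control at the CM carrier).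

## References
[Casselman1995] §3.2 (Frobenius 3.2.4, exactness 3.2.3), §4.4, §6.4, §7.1 · [BernsteinZelevinsky1977] Prop. 1.9 (a)(b), §2.3 · [BushnellHenniart2006] §2.
-/

set_option autoImplicit false

noncomputable section

open scoped MonoidAlgebra
open Literature.RepresentationTheory.FiniteGroups Literature.RepresentationTheory.Semisimple

namespace Literature.NumberTheory.Automorphic

namespace IrrClass

/-- **THE LABELLED PAIR OF `i_P^G σ`** (see the module docstring).  Output, in order: proofs that `ρ|_N`, `ρ⁄N` are irreducible (`ρ = i_P^G σ`),
`⟦ρ|_N⟧ ≠ ⟦ρ⁄N⟧`, the constituents of `ρ` are exactly `⟦ρ⁄N⟧`, `⟦ρ|_N⟧`, `r(ρ|_N) ≅ θ₂`, `r(ρ⁄N) ≅ θ₁`.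
[cite: Casselman1995, L. 7.1.1 (a), Cor. 7.1.2, Prop. 7.1.3, Prop. 6.4.1, Thm 3.2.4, Thm 4.4.6] [cite: BernsteinZelevinsky1977, Prop. 1.9, Cor. 2.13 (c)] -/
theorem labelledPair_of_line_normalizedInd {G : Type} [Group G] [TopologicalSpace G] [IsTopologicalGroup G]
    (t : ParabolicTriple G) [LocallyCompactSpace t.P] {W : Type} [AddCommGroup W] [Module ℂ W] {σ : Representation ℂ ↥t.M W}
    {θ₁ θ₂ : ↥t.M →* ℂˣ}
    (hfd : FiniteDimensional ℂ (t.restrict (Representation.normalizedInd t σ)).Coinvariants)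
    (h2 : Module.finrank ℂ (t.restrict (Representation.normalizedInd t σ)).Coinvariants = 2)
    (ℓ : Submodule ℂ (t.restrict (Representation.normalizedInd t σ)).Coinvariants) (hℓ1 : Module.finrank ℂ ↥ℓ = 1)
    (hℓ : ∀ (m : ↥t.M), ∀ x ∈ ℓ, (Representation.normalizedInd t σ).normalizedJacquet t m x = ((θ₁ m : ℂˣ) : ℂ) • x)
    (hq : ∀ (m : ↥t.M) (x : (t.restrict (Representation.normalizedInd t σ)).Coinvariants),
      (Representation.normalizedInd t σ).normalizedJacquet t m x - ((θ₂ m : ℂˣ) : ℂ) • x ∈ ℓ)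
    (hNlim : IsLimitOfCompactOpen t.N) (hδ : ∀ (n : G) (hn : n ∈ t.N), deltaChar t.P ⟨n, t.N_le hn⟩ = 1)
    (hρ : (Representation.normalizedInd t σ).IsSmooth) (N : Subrepresentation (Representation.normalizedInd t σ))
    (hNb : N ≠ ⊥) (hNt : N ≠ ⊤)
    (hlen : ∀ N₁ N₂ : Subrepresentation (Representation.normalizedInd t σ), ¬ (⊥ < N₁ ∧ N₁ < N₂ ∧ N₂ < ⊤))
    (hne : θ₁ ≠ θ₂) {D : (↥t.M →* ℂˣ) → Prop}
    (hdecay : ∀ χ' : ↥t.M →* ℂˣ, N.toRepresentation.HasJacquetExponent t χ' → D χ') (hD : ¬ D θ₁) :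
    ∃ (hN : N.toRepresentation.IsIrreducible) (hQ : N.quotientRep.IsIrreducible),
      IrrClass.mk (SmoothIrrep.mk ↥N.toSubmodule N.toRepresentation hN (hρ.toRepresentation N)) ≠
          IrrClass.mk (SmoothIrrep.mk (_ ⧸ N.toSubmodule) N.quotientRep hQ (hρ.quotientRep N)) ∧
        (∀ c : IrrClass G, c.IsConstituentOf (Representation.normalizedInd t σ) ↔
          (c = IrrClass.mk (SmoothIrrep.mk (_ ⧸ N.toSubmodule) N.quotientRep hQ (hρ.quotientRep N)) ∨
            c = IrrClass.mk (SmoothIrrep.mk ↥N.toSubmodule N.toRepresentation hN (hρ.toRepresentation N)))) ∧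
        Nonempty ((N.toRepresentation.normalizedJacquet t).Equiv ((Representation.trivial ℂ ↥t.M ℂ).twist θ₂)) ∧
        Nonempty ((N.quotientRep.normalizedJacquet t).Equiv ((Representation.trivial ℂ ↥t.M ℂ).twist θ₁)) := by
  have hN : N.toRepresentation.IsIrreducible := isIrreducible_toRepresentation_of_forall_not_lt_lt hlen hNb hNt
  have hQ : N.quotientRep.IsIrreducible := isIrreducible_quotientRep_of_forall_not_lt_lt hlen hNb hNt
  -- `r(ρ|_N) ≠ 0` by Frobenius reciprocity on the inclusion `ρ|_N ↪ i_P^G σ`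
  haveI : Nontrivial (t.restrict N.toRepresentation).Coinvariants := by
    obtain ⟨e⟩ := Representation.frobenius_normalizedInd_holds t hδ N.toRepresentation σ (hρ.toRepresentation N)
    have hφ : e (Subrepresentation.subtypeIntertwiningMap N) ≠ 0 :=
      fun h0 => Subrepresentation.subtypeIntertwiningMap_ne_zero hNb ((LinearEquiv.map_eq_zero_iff e).1 h0)
    by_contra htriv
    rw [not_nontrivial_iff_subsingleton] at htriv
    exact hφ (Representation.IntertwiningMap.ext (LinearMap.ext fun x => by
      rw [Subsingleton.elim x 0, map_zero]; rfl))
  haveI := hfd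
  have hno : ¬ N.toRepresentation.HasJacquetExponent t θ₁ := fun h => hD (hdecay θ₁ h)
  exact ⟨hN, hQ, labelledPair_of_line t hNlim hρ N hN hQ hne h2 ℓ hℓ1 hℓ hq hno⟩

end IrrClass

end Literature.NumberTheory.Automorphic

end
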